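import Mathlib
import Summits.NavierStokesRegularity.NavierStokesRegularity.Theorems.PoloidalWindowDoorPoloidalWindowRigidityZShockTurningShearIndefinite

/-!
# Crux K2 `PoloidalWindowRigidity` (stmt-NavierStokesRegularity-19708), line `z_shock` — R3 inhabitant census: QUADRATIC SLICES
# WITH AN ARBITRARY STRUCTURE FUNCTION (VI) — the pure saddle, and the consolidated rank-two statement: a NON-DEGENERATE
# INDEFINITE quadratic slice at one height forces a constant structure function

`--supports stmt-NavierStokesRegularity-19708 --as helper` (leafhand-ns-poloidalwindowdoor-3 g21, cell decomp-ns, 2026-09-01).  Class-free,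
def-free; Mathlib + parts II–V of the series (`…ZShockTurningShearQuadratic` p839549, `…Definite` p840033, `…Indefinite`).  **No stub
and no summit is closed by this file; Navier–Stokes regularity is NOT proved here (rung 0).**

Part V (`quadSlice_indef_affine_swap`) left the pure saddle `D = G = 0` (`W = A + By₀ + Cy₁ + Ey₀y₁`, `E ≠ 0`) of the indefinite
case untreated, because its space-like / time-like ray families were built from `D ≠ 0`.  For the saddle the families are explicit:
the directions `(1,1), (1,2)` have `q = 2E, 4E` and weights `2E, 5E/2`, the directions `(1,−1), (1,−2)` have `q = −2E, −4E` and
weights `−2E, −5E/2`; two different weights on each side of the centre value `m`, then gluing at `m` (part V's `affine_of_two_sided`).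

* `quadSlice_saddle_affine_pos`, ★ `quadSlice_saddle_affine` — single height, `D = G = 0`, `E > 0` (resp. `E ≠ 0`, by the reflection
  `y₁ ↦ −y₁`): `γ` is affine on `ℝ`.
* ★ `quadSlice_rank2Indef_affine` — **consolidated single-height statement**: a quadratic slice with `DG − E² < 0` (no further
  condition) satisfying the height-evolution identity at ONE height for a differentiable `γ` forces `γ(t) = γ₀ + 2μt`, `γ'(t) = 2μ` on
  all of `ℝ`.
* ★ `quadSlice_rank2Indef_TH` — **all heights**: with the data of part II at every height and ONE indefinite non-degenerate height,
  `γ' ≡ 0` on `ℝ` (part II's `quadSlice_flat_of_affine_thick` on the globally affine `γ`).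

Census status of the quadratic family after parts I–VI (any differentiable structure function): a quadratic-slice pattern of the
autonomous height-evolution on the THICK column has a SEMI-DEFINITE quadratic part at every height (this file), and is not definite at
every height (part IV); the remaining members have a rank-one (parabolic-cylinder) quadratic part at some height — the named residue.
Honest scope: toy sub-family of R3 (`hGN` stays XL, not in print); kinematic (no NS); ansatz substitution taken as hypothesis.
presearch: as parts III–V. [folklore]
-/

noncomputable section

namespace Summit.NavierStokesRegularity.NavierStokesRegularity.Theorems.PoloidalWindowDoorPoloidalWindowRigidityZShockTurningShearSaddle

-- the summit and its single sub-problem share the name (CONVENTIONS §1)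
set_option linter.dupNamespace false

open Set Filter Topology
open Summit.NavierStokesRegularity.NavierStokesRegularity.Theorems.PoloidalWindowDoorPoloidalWindowRigidityZShockTurningShearQuadratic
open Summit.NavierStokesRegularity.NavierStokesRegularity.Theorems.PoloidalWindowDoorPoloidalWindowRigidityZShockTurningShearDefinite
open Summit.NavierStokesRegularity.NavierStokesRegularity.Theorems.PoloidalWindowDoorPoloidalWindowRigidityZShockTurningShearIndefinite

/-! ## The pure saddle at one height -/

/-- **Pure saddle, `E > 0`.**  If `γ` is differentiable and the saddle slice `W(y) = A + By₀ + Cy₁ + Ey₀y₁` (`D = G = 0`, `E > 0`)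
satisfies `ℓ(y) = γ(W(y))·0 + γ'(W(y))·|∇W(y)|²` for all `y` with some quadratic polynomial `ℓ` (the height-evolution at one height;
`ΔW = 0`), then `γ` is affine on `ℝ`. [folklore] -/
theorem quadSlice_saddle_affine_pos {γ γ' : ℝ → ℝ} (hγ : ∀ t, HasDerivAt γ (γ' t) t)
    {A B C E a b c d e g : ℝ} {W P ℓ : ℝ → ℝ → ℝ}
    (hW : ∀ y₀ y₁, W y₀ y₁ = A + B * y₀ + C * y₁ + (0 * y₀ ^ 2 + 2 * E * y₀ * y₁ + 0 * y₁ ^ 2) / 2)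
    (hP : ∀ y₀ y₁, P y₀ y₁ = (B + 0 * y₀ + E * y₁) ^ 2 + (C + E * y₀ + 0 * y₁) ^ 2)
    (hℓ : ∀ y₀ y₁, ℓ y₀ y₁ = a + b * y₀ + c * y₁ + (d * y₀ ^ 2 + 2 * e * y₀ * y₁ + g * y₁ ^ 2) / 2)
    (hE : 0 < E)
    (hpde : ∀ y₀ y₁, ℓ y₀ y₁ = γ (W y₀ y₁) * (0 + 0) + γ' (W y₀ y₁) * P y₀ y₁) :
    ∃ γ₀ μ : ℝ, (∀ t, γ t = γ₀ + 2 * μ * t) ∧ (∀ t, γ' t = 2 * μ) := by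
  have hEne : E ≠ 0 := hE.ne'
  -- centre
  obtain ⟨c₀, c₁, hcen₀, hcen₁⟩ : ∃ c₀ c₁ : ℝ, B + E * c₁ = 0 ∧ C + E * c₀ = 0 :=
    ⟨-C / E, -B / E, by field_simp; ring, by field_simp; ring⟩
  set m := W c₀ c₁ with hm
  have hWray : ∀ t d₀ d₁ : ℝ, W (c₀ + t * d₀) (c₁ + t * d₁) = m + t ^ 2 * (2 * E * d₀ * d₁) / 2 := by
    intro t d₀ d₁
    rw [hW, hm, hW]
    linear_combination (t * d₀) * hcen₀ + (t * d₁) * hcen₁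
  have hPray : ∀ t d₀ d₁ : ℝ, P (c₀ + t * d₀) (c₁ + t * d₁) = t ^ 2 * ((E * d₁) ^ 2 + (E * d₀) ^ 2) := by
    intro t d₀ d₁
    rw [hP]
    have h1 : B + 0 * (c₀ + t * d₀) + E * (c₁ + t * d₁) = t * (E * d₁) := by linear_combination hcen₀
    have h2 : C + E * (c₀ + t * d₀) + 0 * (c₁ + t * d₁) = t * (E * d₀) := by linear_combination hcen₁
    rw [h1, h2]; ring
  have hℓray : ∀ t d₀ d₁ : ℝ, ℓ (c₀ + t * d₀) (c₁ + t * d₁) + ℓ (c₀ + (-t) * d₀) (c₁ + (-t) * d₁) =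
      2 * ℓ c₀ c₁ + t ^ 2 * (d * d₀ ^ 2 + 2 * e * d₀ * d₁ + g * d₁ ^ 2) := by
    intro t d₀ d₁
    rw [hℓ, hℓ, hℓ]; ring
  -- ray identity (`T = 0`)
  have ray : ∀ d₀ d₁ q p r : ℝ, q = 2 * E * d₀ * d₁ → p = (E * d₁) ^ 2 + (E * d₀) ^ 2 →
      r = d * d₀ ^ 2 + 2 * e * d₀ * d₁ + g * d₁ ^ 2 → q ≠ 0 → ∀ τ, 0 ≤ 2 * τ / q →
      (0 + 0) * γ (m + τ) + (2 * p / q) * τ * γ' (m + τ) = ℓ c₀ c₁ + (r / q) * τ := by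
    intro d₀ d₁ q p r hq hp hr hqne τ hτ
    set t := Real.sqrt (2 * τ / q) with ht
    have ht2 : t ^ 2 = 2 * τ / q := by rw [ht, Real.sq_sqrt hτ]
    have hnt2 : (-t) ^ 2 = 2 * τ / q := by rw [neg_sq, ht2]
    have hWp : W (c₀ + t * d₀) (c₁ + t * d₁) = m + τ := by
      rw [hWray, ← hq, ht2]; field_simp
    have hWn : W (c₀ + (-t) * d₀) (c₁ + (-t) * d₁) = m + τ := by
      rw [hWray, ← hq, hnt2]; field_simp
    have hPp : P (c₀ + t * d₀) (c₁ + t * d₁) = 2 * τ / q * p := by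
      rw [hPray, ← hp, ht2]
    have hPn : P (c₀ + (-t) * d₀) (c₁ + (-t) * d₁) = 2 * τ / q * p := by
      rw [hPray, ← hp, hnt2]
    have h1 := hpde (c₀ + t * d₀) (c₁ + t * d₁)
    have h2 := hpde (c₀ + (-t) * d₀) (c₁ + (-t) * d₁)
    have h3 := hℓray t d₀ d₁
    rw [hWp, hPp] at h1
    rw [hWn, hPn] at h2
    rw [← hr, ht2] at h3
    linear_combination (h3 - h1 - h2) / 2
  -- four explicit directions
  have h2E : (0:ℝ) < 2 * E := by linarith
  have h4E : (0:ℝ) < 4 * E := by linarith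
  have ray₁ : ∀ τ, 0 ≤ τ → (0 + 0) * γ (m + τ) + (2 * (2 * E ^ 2) / (2 * E)) * τ * γ' (m + τ) =
      ℓ c₀ c₁ + ((d + 2 * e + g) / (2 * E)) * τ := fun τ hτ =>
    ray 1 1 (2 * E) (2 * E ^ 2) (d + 2 * e + g) (by ring) (by ring) (by ring) h2E.ne' τ (div_nonneg (by linarith) h2E.le)
  have ray₂ : ∀ τ, 0 ≤ τ → (0 + 0) * γ (m + τ) + (2 * (5 * E ^ 2) / (4 * E)) * τ * γ' (m + τ) =
      ℓ c₀ c₁ + ((d + 4 * e + 4 * g) / (4 * E)) * τ := fun τ hτ =>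
    ray 1 2 (4 * E) (5 * E ^ 2) (d + 4 * e + 4 * g) (by ring) (by ring) (by ring) h4E.ne' τ (div_nonneg (by linarith) h4E.le)
  have ray₃ : ∀ τ, τ ≤ 0 → (0 + 0) * γ (m + τ) + (2 * (2 * E ^ 2) / (-(2 * E))) * τ * γ' (m + τ) =
      ℓ c₀ c₁ + ((d - 2 * e + g) / (-(2 * E))) * τ := fun τ hτ =>
    ray 1 (-1) (-(2 * E)) (2 * E ^ 2) (d - 2 * e + g) (by ring) (by ring) (by ring) (neg_ne_zero.mpr h2E.ne') τ
      (div_nonneg_of_nonpos (by linarith) (by linarith))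
  have ray₄ : ∀ τ, τ ≤ 0 → (0 + 0) * γ (m + τ) + (2 * (5 * E ^ 2) / (-(4 * E))) * τ * γ' (m + τ) =
      ℓ c₀ c₁ + ((d - 4 * e + 4 * g) / (-(4 * E))) * τ := fun τ hτ =>
    ray 1 (-2) (-(4 * E)) (5 * E ^ 2) (d - 4 * e + 4 * g) (by ring) (by ring) (by ring) (neg_ne_zero.mpr h4E.ne') τ
      (div_nonneg_of_nonpos (by linarith) (by linarith))
  -- the weights differ on each side
  have hσ₁₂ : 2 * (2 * E ^ 2) / (2 * E) ≠ 2 * (5 * E ^ 2) / (4 * E) := by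
    rw [Ne, div_eq_div_iff h2E.ne' h4E.ne']
    intro h
    have : 4 * E ^ 3 = 0 := by linear_combination (-1 : ℝ) * h
    exact hEne (pow_eq_zero_iff (by norm_num : 3 ≠ 0) |>.mp (by linarith))
  have hσ₃₄ : 2 * (2 * E ^ 2) / (-(2 * E)) ≠ 2 * (5 * E ^ 2) / (-(4 * E)) := by
    rw [Ne, div_eq_div_iff (neg_ne_zero.mpr h2E.ne') (neg_ne_zero.mpr h4E.ne')]
    intro h
    have : 4 * E ^ 3 = 0 := by linear_combination (1 : ℝ) * h
    exact hEne (pow_eq_zero_iff (by norm_num : 3 ≠ 0) |>.mp (by linarith))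
  have hkP := deriv_eq_of_two_rays hσ₁₂ ray₁ ray₂
  have hkN := deriv_eq_of_two_rays_neg hσ₃₄ ray₃ ray₄
  exact affine_of_two_sided hγ hkP (fun τ hτ => by
    have h1 := hkN (-τ) (by linarith)
    rwa [← sub_eq_add_neg] at h1)

/-- ★ **Pure saddle, `E ≠ 0`** (the case `E < 0` by the reflection `y₁ ↦ −y₁`, which preserves the height-evolution). [folklore] -/
theorem quadSlice_saddle_affine {γ γ' : ℝ → ℝ} (hγ : ∀ t, HasDerivAt γ (γ' t) t)
    {A B C E a b c d e g : ℝ} {W P ℓ : ℝ → ℝ → ℝ}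
    (hW : ∀ y₀ y₁, W y₀ y₁ = A + B * y₀ + C * y₁ + (0 * y₀ ^ 2 + 2 * E * y₀ * y₁ + 0 * y₁ ^ 2) / 2)
    (hP : ∀ y₀ y₁, P y₀ y₁ = (B + 0 * y₀ + E * y₁) ^ 2 + (C + E * y₀ + 0 * y₁) ^ 2)
    (hℓ : ∀ y₀ y₁, ℓ y₀ y₁ = a + b * y₀ + c * y₁ + (d * y₀ ^ 2 + 2 * e * y₀ * y₁ + g * y₁ ^ 2) / 2)
    (hE : E ≠ 0)
    (hpde : ∀ y₀ y₁, ℓ y₀ y₁ = γ (W y₀ y₁) * (0 + 0) + γ' (W y₀ y₁) * P y₀ y₁) :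
    ∃ γ₀ μ : ℝ, (∀ t, γ t = γ₀ + 2 * μ * t) ∧ (∀ t, γ' t = 2 * μ) := by
  rcases lt_or_gt_of_ne hE with hneg | hpos
  · exact quadSlice_saddle_affine_pos hγ (A := A) (B := B) (C := -C) (E := -E) (a := a) (b := b) (c := -c) (d := d)
      (e := -e) (g := g) (W := fun y₀ y₁ => W y₀ (-y₁)) (P := fun y₀ y₁ => P y₀ (-y₁)) (ℓ := fun y₀ y₁ => ℓ y₀ (-y₁))
      (fun y₀ y₁ => by rw [hW]; ring) (fun y₀ y₁ => by rw [hP]; ring) (fun y₀ y₁ => by rw [hℓ]; ring)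
      (by linarith) (fun y₀ y₁ => hpde y₀ (-y₁))
  · exact quadSlice_saddle_affine_pos hγ hW hP hℓ hpos hpde

/-! ## Consolidated rank-two statements -/

/-- ★ **A non-degenerate indefinite quadratic slice at ONE height forces an affine structure function on `ℝ`** — no condition beyond
`DG − E² < 0` (part V for `D ≠ 0 ∨ G ≠ 0`, the saddle theorem for `D = G = 0`). [folklore] -/
theorem quadSlice_rank2Indef_affine {γ γ' : ℝ → ℝ} (hγ : ∀ t, HasDerivAt γ (γ' t) t)
    {A B C D E G a b c d e g : ℝ} {W P ℓ : ℝ → ℝ → ℝ}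
    (hW : ∀ y₀ y₁, W y₀ y₁ = A + B * y₀ + C * y₁ + (D * y₀ ^ 2 + 2 * E * y₀ * y₁ + G * y₁ ^ 2) / 2)
    (hP : ∀ y₀ y₁, P y₀ y₁ = (B + D * y₀ + E * y₁) ^ 2 + (C + E * y₀ + G * y₁) ^ 2)
    (hℓ : ∀ y₀ y₁, ℓ y₀ y₁ = a + b * y₀ + c * y₁ + (d * y₀ ^ 2 + 2 * e * y₀ * y₁ + g * y₁ ^ 2) / 2)
    (hdet : D * G - E ^ 2 < 0)
    (hpde : ∀ y₀ y₁, ℓ y₀ y₁ = γ (W y₀ y₁) * (D + G) + γ' (W y₀ y₁) * P y₀ y₁) :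
    ∃ γ₀ μ : ℝ, (∀ t, γ t = γ₀ + 2 * μ * t) ∧ (∀ t, γ' t = 2 * μ) := by
  by_cases hDG : D ≠ 0 ∨ G ≠ 0
  · exact quadSlice_indef_affine_swap hγ hW hP hℓ hDG hdet hpde
  · rw [not_or, not_ne_iff, not_ne_iff] at hDG
    obtain ⟨hD0, hG0⟩ := hDG
    subst hD0
    subst hG0
    have hE : E ≠ 0 := by
      intro h; rw [h] at hdet; norm_num at hdet
    exact quadSlice_saddle_affine hγ hW hP hℓ hE hpde

/-- ★ **One non-degenerate indefinite height ⇒ constant structure function.**  Data of part II at every height, `γ` differentiable; if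
`D(z₀)G(z₀) − E(z₀)² < 0` at one height `z₀` then `γ' ≡ 0` on `ℝ` (the pattern can only live on the linearly degenerate column).
[folklore] -/
theorem quadSlice_rank2Indef_TH {A B C D E G A'' B'' C'' D' G' D'' E'' G'' γ γ' : ℝ → ℝ}
    (hγ : ∀ t, HasDerivAt γ (γ' t) t)
    (hD : ∀ z, HasDerivAt D (D' z) z) (hD' : ∀ z, HasDerivAt D' (D'' z) z)
    (hG : ∀ z, HasDerivAt G (G' z) z) (hG' : ∀ z, HasDerivAt G' (G'' z) z)
    {z₀ : ℝ} (hindef : D z₀ * G z₀ - E z₀ ^ 2 < 0)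
    (hpde : ∀ z y₀ y₁ : ℝ,
      A'' z + B'' z * y₀ + C'' z * y₁ + (D'' z * y₀ ^ 2 + 2 * E'' z * y₀ * y₁ + G'' z * y₁ ^ 2) / 2 =
        γ (A z + B z * y₀ + C z * y₁ + (D z * y₀ ^ 2 + 2 * E z * y₀ * y₁ + G z * y₁ ^ 2) / 2) * (D z + G z) +
          γ' (A z + B z * y₀ + C z * y₁ + (D z * y₀ ^ 2 + 2 * E z * y₀ * y₁ + G z * y₁ ^ 2) / 2) *
            ((B z + D z * y₀ + E z * y₁) ^ 2 + (C z + E z * y₀ + G z * y₁) ^ 2)) :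
    ∀ t, γ' t = 0 := by
  obtain ⟨γ₀, μ, hγaff, hγ'⟩ := quadSlice_rank2Indef_affine hγ
    (W := fun y₀ y₁ => A z₀ + B z₀ * y₀ + C z₀ * y₁ + (D z₀ * y₀ ^ 2 + 2 * E z₀ * y₀ * y₁ + G z₀ * y₁ ^ 2) / 2)
    (P := fun y₀ y₁ => (B z₀ + D z₀ * y₀ + E z₀ * y₁) ^ 2 + (C z₀ + E z₀ * y₀ + G z₀ * y₁) ^ 2)
    (ℓ := fun y₀ y₁ => A'' z₀ + B'' z₀ * y₀ + C'' z₀ * y₁ + (D'' z₀ * y₀ ^ 2 + 2 * E'' z₀ * y₀ * y₁ + G'' z₀ * y₁ ^ 2) / 2)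
    (fun _ _ => rfl) (fun _ _ => rfl) (fun _ _ => rfl) hindef (fun y₀ y₁ => hpde z₀ y₀ y₁)
  have hpde' : ∀ z y₀ y₁ : ℝ,
      A'' z + B'' z * y₀ + C'' z * y₁ + (D'' z * y₀ ^ 2 + 2 * E'' z * y₀ * y₁ + G'' z * y₁ ^ 2) / 2 =
        (γ₀ + 2 * μ * (A z + B z * y₀ + C z * y₁ + (D z * y₀ ^ 2 + 2 * E z * y₀ * y₁ + G z * y₁ ^ 2) / 2)) *
            (D z + G z) +
          2 * μ * ((B z + D z * y₀ + E z * y₁) ^ 2 + (C z + E z * y₀ + G z * y₁) ^ 2) := by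
    intro z y₀ y₁
    rw [hpde z y₀ y₁, hγaff, hγ']
  have hμ0 : μ = 0 := by
    by_contra hne
    have h1 := quadSlice_flat_of_affine_thick hne hD hD' hG hG' hpde' z₀
    rw [h1.1, h1.2.1, h1.2.2] at hindef
    norm_num at hindef
  intro t
  rw [hγ' t, hμ0, mul_zero]

end Summit.NavierStokesRegularity.NavierStokesRegularity.Theorems.PoloidalWindowDoorPoloidalWindowRigidityZShockTurningShearSaddle

end
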